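import Literature.MathematicalPhysics.QuantumFieldTheory.Balaban1983to89.B3Op116DKernelRegularBox
import Literature.MathematicalPhysics.QuantumFieldTheory.Balaban1983to89.B3Op116FaceSumsBorderline
import Literature.MathematicalPhysics.QuantumFieldTheory.Balaban1983to89.B3Op116BoxRows
import Literature.MathematicalPhysics.QuantumFieldTheory.Balaban1983to89.B3Op116CollarBoxFaces
import Literature.MathematicalPhysics.QuantumFieldTheory.Balaban1983to89.B3Op116CellBoxFaceFamily

/-!
# `Balaban1983to89.B3Op116DKernelRegularCellBox` — T. Bałaban, *(Higgs)₂,₃ quantum fields in a finite volume. III. Renormalization*,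
# Commun. Math. Phys. **88** (1983) 411–445 [Balaban1983Higgs3], (1.16) p. 414 / (2.5)–(2.6) p. 424 / (2.10) p. 426 / p. 433:
# **THE KERNEL OF (1.16) ON A CELL-PRODUCT BOX `□` OF BIG BLOCKS — PERTURBATION `Ã` SUPPORTED ANYWHERE IN `□` UP TO ITS FACES — IS UNIFORMLY
# BOUNDED AND EXPONENTIALLY DECAYING AT EVERY POINT OF `□` (`n + n′ + 2 > d`), AND SO IS ITS ROW DERIVATIVE AT THE BONDS ONE TOP BLOCK INSIDE
# THE FACES (`n + n′ + 1 > d`), UNIFORMLY IN `k`**: (i) the displayed end sheet of `B3Op116DKernelRegularBox.kernel116_deriv_box_le` resolved under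
# the margin `θL^k` by p35 g26's `B3Op116FaceSumsBorderline.face_sum_kernel_one_margin_le` (print's placement «□₁ in the center of □», p. 433), and
# (ii) the plug on p35 g21's `R₀`-free box members of (2.10) (`B3Op116BoxRows.colB_dcolB_le`) and p40 g77's face family of a box
# (`B3Op116CollarBoxFaces`) — the (C)-level value / derivative binders of (2.5) for (1.16) on `□` WITHOUT the support clause of p. 412 (GAPS.md
# G-B3-16.A1, route γ′; p35 `DESIGN-FILE4.md` §14 RESULT / §16)

statement-level skeleton of published theorems with citation tags; proofs where landed; nothing here is a claim about the Yang–Mills mass gap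

PDF held: `paper:balaban1983-higgs-2-3-quantum-fields-finite-volume` (journal page = PDF page + 410; p. 414 = `p0004.txt`, p. 426 = `p0016.txt`,
p. 433 = `p0023.txt`); `paper:balaban1982-cmp85-higgs23-i` (p. 611 = PDF 9).

CITATION HEADER (lean-in-tree rule).  T. Bałaban, CMP **88** (1983) 411–445 [Balaban1983Higgs3]: (1.16) p. 414, (2.5)/(2.6) p. 424, (2.10)
p. 426, p. 433; part I, CMP **85** (1982) 603–636 [Balaban1982Higgs1]: Prop. 2.1 p. 610, p. 611 l.1–2 (boxes of big blocks), (3.16)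
p. 615.  Cell `lit-balaban` (HOME `run/shared/lean/pub/lit-balaban/`), Phase-2 proof seat **p35** gen 27 (literature-prover-lit-balaban-p35-g27-0;
free-target protocol G.5-34(d), TAKING HOME/STATUS.md 2026-08-23T16:58:04Z, cc p40 / r15 / r14 / p33).  SKELETON rows **B3.Eq1.16** / **B3.Eq2.5** /
**B3.Txt@433** / **B3.Prop1** (owner r15) — LOCATED MEMBERS (no head claim) of the «(2.5) for (1.16) on a cell-product box `□` without the support
clause» programme (GAPS.md G-B3-16.A1, route γ′).  USED BY NAME, never restated: r14's `B3Ineq210RegularRegion.Interior`, p35's `B3Op116DKernelRegularBox.{kernel116_value_box_le,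
kernel116_deriv_box_le, valCB, derCB, rateB, cvB, cdB, cSB, seqB_pos}`, this seat's `B3Op116CellBoxFaceFamily.{faceFam, faceFam_level,
exB_cover_cellBox, enB_cover_cellBox, height_faceFam, dcol_split_le_maj, inside_of_interior, faces_height_of_interior}`, p35 g26's `B3Op116FaceSumsBorderline.face_sum_kernel_one_margin_le`, p33's
`B3Op116MajorantConvolution.majorant_le_top`, p35 g21's `B3Op116BoxRows.colB_dcolB_le`
((2.10) on `□` at every pair of points / every bond of the box), p40 g77's `B3Op116CollarBoxFaces.{faces, exists_face_of_mem_exB, exists_face_of_mem_enB}`,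
`B3Ineq210RegularBox.cellBox_blockUnion`, r14's `B3Op116KernelRegularTorus.norm_covDeriv_le_add_split`, p35 g22's `B3Op116DKernelRegularTorus.cK1`,
`B3Op116MajorantStep.{maj, maj_shift_left, maj_exponent_reduce, …}`.

WHAT IS PRINTED (verbatim).  p. 414 [PDF 4]: *"for n, n′ sufficiently large, a kernel of the operator (1.16) is a sufficiently regular function of
both variables. More exactly the Hölder norms of the covariant derivatives of this kernel … are exponentially decaying with the distance of the
arguments and are uniformly bounded by O(1)(e(L^kε)^{1−α})^{n+n′} … This estimate follows easily from the properties of the propagators G_k(Ω, A)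
proved in the next paper."*  p. 433 [PDF 23]: *"We take a cube □₁ of size r(L^kε) containing the above cube in the center, and next we take a cube □
of size 3r(L^kε) and with □₁ in the center. We assume that □₁, □ are sums of big blocks of the unit lattice. … We have B̃ = B̃₀ + B̃′, and we expand
in B̃′ … we include the operators (1.16) … into the external fields."*  [B1] p. 611 l.1–2: the regions are unions of rectangular parallelepipeds of
big blocks (the tree's `cellBox`).

WHAT THIS FILE PROVES.  (i) MARGIN, (B)-level on a `k`-block union `Ω`: §M1 `sheetEndC` (the end-sheet constant
`c_{K1}·cS_M·(8d/δ_M)^{d−1}(ε^{d−1})^{−1}(r/(1−r) + L^M/(L^M−1))`, `r = e^{−δ_Mθ(L−1)/(2d)}`) and **`end_sheet_margin_le`**: at a point `x` with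
`θL^k ≤ min((x_{ν_i} − c_i).val, (c_i − x_{ν_i}).val)` for every face `i`, the displayed sheet
`Σ_iΣ_{u∈F_i}𝔪_k(c_{K1},1;δ_M)(x,u)·𝔪_k(cS_M,1+M;δ_M)(u,x′) ≤ n_F·𝔪_k(sheetEndC, 1+M; δ_M/2)(x,x′)`; §M2 **`kernel116_deriv_box_margin_le`**: under the
hypotheses of `kernel116_deriv_box_le` and the height condition, for `d < n + n′ + 1`,
`ε^{−d}Σ_{i′}‖(D^ε_B(1.16)^Ω_{n,n′}e_{(x′,i′)})(⟨x,μ⟩)‖ ≤ derCBθ(n+n′)·(L^kε)^{n+n′}·((L^kε)((L^kε)^d)^{−1})·e^{−(δ_{n+n′}/2)|x−x′|/L^k}`,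
`derCBθ = derCB + ε^{−d}·N·n_F·sheetEndC/(L^{1+M−d} − 1)` — p40's binder shape `hDv`, uniform in `k`, at every bond one top block inside the faces.
(ii) THE PLUG, (C)-level (face family and split column from `B3Op116CellBoxFaceFamily`): §3 **`kernel116_value_cellBox_le`** / **`kernel116_deriv_cellBox_margin_le`**: for `d ≥ 1`, `L ≥ 2`, `a, m² > 0`, `N`,
every charge: `∃K₀min ∀K₀ ≥ K₀min ∃ t, δ₁, C > 0` such that for every volume with these `d, L`, `K₀ ∣ M`, every `1 ≤ k ≤ K` with `L^kε ≤ 1`,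
`3L^kK₀ ≤ |T_ε|_μ`, every `S`, every `A, B` with `B` and `A + B` regular on `□ = cellBox k K₀ S` (`L^kδ|e| ≤ t`), `sup|A| ≤ s`, `A` regular with `δ_A` on
`T_ε`, every `n, n′`: (value, `d < n+n′+2`) for EVERY `x` and every `x′ ∈ □`,
`ε^{−d}Σ_{i′}‖((1.16)^□_{n,n′}e_{(x′,i′)})(x)‖ ≤ valCB(…)(n+n′)·(L^kε)^{n+n′}·(L^kε)²((L^kε)^d)^{−1}·e^{−δ_{n+n′}|x−x′|/L^k}`; (derivative, `d < n+n′+1`) at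
every bond `⟨x,x+εe_μ⟩ ⊂ □` with `θL^k ≤` the lattice height of `x` above every face level of `□`: the same shape with `derCBθ`, one exponent lower,
rate `δ_{n+n′}/2` — with `δ_M = min(δ₁,1)/(4L)^M` and NO support clause on `A` (p. 412's deep-support regime of R1–R5 is not assumed).
(iii) §4 **`kernel116_deriv_cellBox_interior_le`** = (ii)'s derivative member with the bond/height hypotheses replaced by `Interior k K₀ □ x` (`θ = 1`,
via `B3Op116CellBoxFaceFamily.{inside_of_interior, faces_height_of_interior}`) — p40's binder `hDv` of `ineq25At_op116_smooth_of_bounds` on `Ω = □` verbatim.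
HONEST SCOPE.  The margin `θL^k` is in lattice units against the face HYPERPLANE levels (for a product box: its boundary hyperplanes); at bonds
closer than `L^k` to a face the sheet is NOT `O(1)` uniformly in `k` (the logarithm of p35 `DESIGN-FILE4.md` §14 (a)) — not claimed.  The constants
`valCB`, `derCBθ` are the explicit recursions of `B3Op116DKernelRegularBox` at `c_{K2} = ε^dC`, `c_{K1} = ε^dC(1+e|e|sL^kε)`,
`n_F = |faces(S)| ≤ 2Σ_ν|S_ν|` (p40's `card_faces_le`); they are not simplified to print's `O(1)(e(L^kε))^{n+n′}` (every step multiplies by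
`|e|s·O(1) + ε⁻¹|e|δ_A·L^kε·O(1) + …` as on the torus — cosmetic, not done).  The derivative member needs the margin `θL^k` (print's `□₁ ⊂ □`,
p. 433); bonds closer to `∂□` are NOT covered (G-B3-16.A1 remark: the new-vertex classes «anywhere in □»).  Hölder / mixed members (F5) and r15's
`Ineq25At` assembly are not here.  Two `def`s (`sheetEndC`, `derCBθ`: displayed constants); no `def … : Prop`, no new named fact, no `sorry`; axioms standard.  Value = located member
of a by-reference step of B3 — NOT summit progress and nothing about the Yang–Mills mass gap.
-/

noncomputable section

open scoped BigOperators

namespace Literature.MathematicalPhysics.QuantumFieldTheory.Balaban1983to89.B3Op116DKernelRegularCellBox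

open HiggsLattice (ChargeData ScalarField covDeriv)
open HiggsCovariance (propagatorK E)
open HiggsCovariancePos (Inside)
open HiggsAveraging (blockIter)
open B1Eq230FluctCov (Ix cb)
open B3Op116MajorantStep (maj maj_nonneg maj_rate_mono maj_const_mono maj_add mul_maj maj_shift_left maj_exponent_reduce)
open B3Op116MajorantConvolution (majorant_le_top)
open B3Op116CollarSources (exB enB mem_exB mem_enB)
open B3Op116DKernelRegularTorus (mesh_rpow_split_one rate_div_eq cK1 cK1_ge)
open B3Op116DKernelRegularBox (rateB cvB cdB cSB seqB_pos derCB kernel116_deriv_box_le valCB kernel116_value_box_le)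
open B3Op116FaceSumsBorderline (face_sum_kernel_one_margin_le)
open B3Eq116TwoSidedExpansion (op116)
open B1TorusCubeCover (half)
open B1Ineq225RegularBox (cellBox mem_cellBox)
open B3Ineq210RegularBox (cellBox_blockUnion)
open B3Op116CollarBoxFaces (faces exists_face_of_mem_exB exists_face_of_mem_enB)
open B3Op116KernelRegularTorus (norm_covDeriv_le_add_split)
open B3Op116BoxRows (colB_dcolB_le)
open B3Op116CellBoxFaceFamily (faceFam faceFam_level exB_cover_cellBox enB_cover_cellBox height_faceFam dcol_split_le_maj inside_of_interior
  faces_height_of_interior)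

variable {P : HiggsLattice.Params} {N : ℕ}

/-! ## §1 The end sheet under the margin -/

section Sheet

/-- **The end-sheet constant** for one face at height `≥ θL^k`: `c_{K1}·c_S·(8d/δ)^{d−1}(ε^{d−1})^{−1}·(r/(1−r) + L^{s−1}/(L^{s−1}−1))`, `r = e^{−δθ(L−1)/(2d)}`
(`B3Op116FaceSumsBorderline.face_sum_kernel_one_margin_le`). [cite: Balaban1983Higgs3, (1.16) p.414, (2.6) p.424, p.433] -/
def sheetEndC (P : HiggsLattice.Params) (δ θ s cK1 cS : ℝ) : ℝ :=
  cK1 * cS * ((8 * P.d / δ) ^ (P.d - 1) * (P.mesh 0 ^ (P.d - 1))⁻¹ *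
    (Real.exp (-(δ * θ * ((P.L : ℝ) - 1) / (2 * P.d))) / (1 - Real.exp (-(δ * θ * ((P.L : ℝ) - 1) / (2 * P.d))))
      + (P.L : ℝ) ^ (s - 1) / ((P.L : ℝ) ^ (s - 1) - 1)))

/-- `sheetEndC ≥ 0` (`δ, θ > 0`, `L > 1`, `s > 1`, `c_{K1}, c_S ≥ 0`). [cite: Balaban1983Higgs3, (2.6) p.424] -/
theorem sheetEndC_nonneg (hL : 1 < P.L) {δ θ s cK1 cS : ℝ} (hδ : 0 < δ) (hθ : 0 < θ) (hs : 1 < s) (hcK1 : 0 ≤ cK1) (hcS : 0 ≤ cS) :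
    0 ≤ sheetEndC P δ θ s cK1 cS := by
  have hL1 : (1 : ℝ) < (P.L : ℝ) := by exact_mod_cast hL
  have hd0 : (0 : ℝ) < P.d := by exact_mod_cast P.hd
  have ha0 : 0 < δ * θ * ((P.L : ℝ) - 1) / (2 * P.d) := div_pos (mul_pos (mul_pos hδ hθ) (by linarith)) (by positivity)
  have hr1 : Real.exp (-(δ * θ * ((P.L : ℝ) - 1) / (2 * P.d))) < 1 := Real.exp_lt_one_iff.mpr (by linarith)
  have h1 : 0 ≤ Real.exp (-(δ * θ * ((P.L : ℝ) - 1) / (2 * P.d))) / (1 - Real.exp (-(δ * θ * ((P.L : ℝ) - 1) / (2 * P.d)))) :=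
    div_nonneg (Real.exp_nonneg _) (by linarith)
  have h2 : 0 < (P.L : ℝ) ^ (s - 1) - 1 := by have := Real.one_lt_rpow hL1 (by linarith : 0 < s - 1); linarith
  have h3 : 0 ≤ (P.L : ℝ) ^ (s - 1) := Real.rpow_nonneg (by positivity) _
  have h4 : 0 ≤ (P.mesh 0 ^ (P.d - 1))⁻¹ := inv_nonneg.mpr (pow_nonneg (P.mesh_pos 0).le _)
  unfold sheetEndC
  positivity

/-- **THE END SHEET UNDER THE MARGIN**: for faces `F_i ⊆ {u_{ν_i} = c_i}` and a point `x` with `θL^k ≤ min((x_{ν_i} − c_i).val, (c_i − x_{ν_i}).val)` for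
every `i` (`θ > 0`; `0 < δ ≤ 1`, `s > 1`, `c_{K1}, c_S ≥ 0`):
`Σ_iΣ_{u∈F_i}𝔪_k(c_{K1},1;δ)(x,u)·𝔪_k(c_S,s;δ)(u,x′) ≤ n_F·𝔪_k(sheetEndC, s; δ/2)(x,x′)` — uniform in `k`. [cite: Balaban1983Higgs3, (1.16) p.414, (2.6) p.424, (2.10) p.426, p.433] -/
theorem end_sheet_margin_le (hL : 1 < P.L) {k : ℕ} {δ θ s cK1 cS : ℝ} (hδ : 0 < δ) (hδ1 : δ ≤ 1) (hθ : 0 < θ) (hs : 1 < s)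
    (hcK1 : 0 ≤ cK1) (hcS : 0 ≤ cS) {nF : ℕ} (F : Fin nF → Finset (HiggsLattice.Site P 0)) (ν : Fin nF → Fin P.d)
    (c : (i : Fin nF) → ZMod (P.sitesPerDir 0 (ν i))) (hF : ∀ i, ∀ u ∈ F i, u (ν i) = c i) (x x' : HiggsLattice.Site P 0)
    (hh : ∀ i, θ * (P.L : ℝ) ^ k ≤ ((min (x (ν i) - c i).val (c i - x (ν i)).val : ℕ) : ℝ)) :
    ∑ i : Fin nF, ∑ u ∈ F i, maj P k cK1 1 δ x u * maj P k cS s δ u x' ≤ (nF : ℝ) * maj P k (sheetEndC P δ θ s cK1 cS) s (δ / 2) x x' := by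
  have hface : ∀ i : Fin nF, ∑ u ∈ F i, maj P k cK1 1 δ x u * maj P k cS s δ u x' ≤ maj P k (sheetEndC P δ θ s cK1 cS) s (δ / 2) x x' := by
    intro i
    have h := face_sum_kernel_one_margin_le (P := P) hL (k := k) hδ hδ1 hs hcK1 hcS hθ (hF i) x x' (hh i)
      (fun u => maj P k cK1 1 δ x u) (fun u => maj P k cS s δ u x') (fun u _ => maj_nonneg hcK1 _ _) (fun u _ => maj_nonneg hcS _ _)
      (fun u _ => le_of_eq rfl) (fun u _ => le_of_eq rfl)
    refine h.trans (le_of_eq ?_)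
    unfold maj sheetEndC
    rfl
  calc ∑ i : Fin nF, ∑ u ∈ F i, maj P k cK1 1 δ x u * maj P k cS s δ u x'
      ≤ ∑ _i : Fin nF, maj P k (sheetEndC P δ θ s cK1 cS) s (δ / 2) x x' := Finset.sum_le_sum fun i _ => hface i
    _ = _ := by rw [Finset.sum_const, Finset.card_univ, Fintype.card_fin, nsmul_eq_mul]

end Sheet

/-! ## §2 The row derivative of the kernel of (1.16) at bonds one top block inside the faces -/

section Kernel

/-- the derivative constant with the margin: `derCB(M) + ε^{−d}·N·n_F·sheetEndC(δ_M, θ, 1+M, c_{K1}, cS_M)/(L^{1+M−d} − 1)`.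
[cite: Balaban1983Higgs3, (1.16) p.414, p.433] -/
def derCBθ (P : HiggsLattice.Params) (N : ℕ) (C : ChargeData N) (k nF : ℕ) (a cK2 cK1 s δA δ₁ θ : ℝ) (M : ℕ) : ℝ :=
  derCB P N C k nF a cK2 cK1 s δA δ₁ M
    + (P.mesh 0 ^ P.d)⁻¹ * (Fintype.card (Ix N) : ℝ) * ((nF : ℝ) *
        (sheetEndC P (rateB P N C k nF a cK2 cK1 s δA δ₁ cK2 cK1 M) θ (1 + (M : ℝ)) cK1 (cSB P N C k nF a cK2 cK1 s δA δ₁ cK2 cK1 M)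
          / ((P.L : ℝ) ^ ((1 : ℝ) + (M : ℝ) - (P.d : ℝ)) - 1)))

variable {C : ChargeData N} {Ω : Finset (HiggsLattice.Site P 0)} {A B : HiggsLattice.VecField P 0} {msq a : ℝ} {k : ℕ}
  {δ₁ s δA cK2 cK1 : ℝ} {nF : ℕ} {F : Fin nF → Finset (HiggsLattice.Site P 0)} {ν : Fin nF → Fin P.d}
  {c : (i : Fin nF) → ZMod (P.sitesPerDir 0 (ν i))}

variable (hL : 1 < P.L) (hk : 1 ≤ k) (hkK : k ≤ P.K) (hmsq : 0 < msq) (hak : 0 ≤ B1.aSeq a P.L k)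
  (hΩ : ∀ x x' : HiggsLattice.Site P 0, blockIter k x = blockIter k x' → (x ∈ Ω ↔ x' ∈ Ω))
  (hcK2 : 0 ≤ cK2) (hcK1 : 0 ≤ cK1)
  (hcolB : ∀ x ∈ Ω, ∀ z ∈ Ω, ∑ i : Ix N, ‖propagatorK C Ω B msq a k (cb P N 0 (z, i)) x‖ ≤ maj P k cK2 2 δ₁ x z)
  (hdcolB : ∀ b : HiggsLattice.PBond P 0, Inside Ω b → ∀ z ∈ Ω,
    ∑ i : Ix N, ‖covDeriv C B (propagatorK C Ω B msq a k (cb P N 0 (z, i))) b‖ ≤ maj P k cK1 1 δ₁ b.src z)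
  (hcolAB : ∀ x ∈ Ω, ∀ z ∈ Ω, ∑ i : Ix N, ‖propagatorK C Ω (A + B) msq a k (cb P N 0 (z, i)) x‖ ≤ maj P k cK2 2 δ₁ x z)
  (hdcolAB : ∀ b : HiggsLattice.PBond P 0, Inside Ω b → ∀ z ∈ Ω,
    ∑ i : Ix N, ‖covDeriv C B (propagatorK C Ω (A + B) msq a k (cb P N 0 (z, i))) b‖ ≤ maj P k cK1 1 δ₁ b.src z)
  (hδ₁ : 0 < δ₁) (hδ₁1 : δ₁ ≤ 1) (hs : 0 ≤ s) (hA : ∀ b : HiggsLattice.PBond P 0, |A b| ≤ s) (hδA : 0 ≤ δA)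
  (hregA : ∀ (z : HiggsLattice.Site P 0) (μ ν : Fin P.d), |A ⟨z.shift ν, μ⟩ - A ⟨z, μ⟩| ≤ δA)
  (i₀ : Ix N) (hF : ∀ i, ∀ u ∈ F i, u (ν i) = c i)
  (hexF : ∀ b ∈ exB Ω A, ∃ i : Fin nF, b.src ∈ F i) (henF : ∀ b ∈ enB Ω A, ∃ i : Fin nF, b.tgt ∈ F i)
  {x' : HiggsLattice.Site P 0} (hx' : x' ∈ Ω)
include hL hk hkK hmsq hak hΩ hcK2 hcK1 hcolB hdcolB hcolAB hdcolAB hδ₁ hδ₁1 hs hA hδA hregA i₀ hF hexF henF hx'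

/-- **THE ROW DERIVATIVE OF THE KERNEL OF (1.16) ON `Ω` IS UNIFORMLY BOUNDED AND EXPONENTIALLY DECAYING AT THE BONDS ONE TOP BLOCK INSIDE THE FACES,
FOR ALL `n + n′ + 1 > d`**: at a bond `⟨x, x+εe_μ⟩ ⊂ Ω` whose base has height `≥ θL^k` above every face slice (`θ > 0`),
`ε^{−d}Σ_{i′}‖(D^ε_B(1.16)^Ω_{n,n′}e_{(x′,i′)})(⟨x,μ⟩)‖ ≤ derCBθ(n+n′)·(L^kε)^{n+n′}·((L^kε)((L^kε)^d)^{−1})·e^{−(δ_{n+n′}/2)|x−x′|/L^k}` — p40's binder shape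
`hDv`, UNIFORM IN `k`; print's placement of the differentiated ends inside `□₁` (p. 433).
[cite: Balaban1983Higgs3, (1.16) p.414, (2.5) p.424, (2.10) p.426, p.433] [cite: Balaban1982Higgs1, (3.16) p.615] -/
theorem kernel116_deriv_box_margin_le (n n' : ℕ) (hd : (P.d : ℝ) < (n + n' : ℕ) + 1) (μ : Fin P.d) (x : HiggsLattice.Site P 0)
    (hxμ : Inside Ω ⟨x, μ⟩) {θ : ℝ} (hθ : 0 < θ)
    (hh : ∀ i, θ * (P.L : ℝ) ^ k ≤ ((min (x (ν i) - c i).val (c i - x (ν i)).val : ℕ) : ℝ)) :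
    (P.mesh 0 ^ P.d)⁻¹ * ∑ i' : Ix N, ‖covDeriv C B (op116 C Ω A B msq a k n n' (cb P N 0 (x', i'))) ⟨x, μ⟩‖
      ≤ derCBθ P N C k nF a cK2 cK1 s δA δ₁ θ (n + n') * P.mesh k ^ (n + n') * (P.mesh k * (P.mesh k ^ P.d)⁻¹) *
          Real.exp (-(rateB P N C k nF a cK2 cK1 s δA δ₁ cK2 cK1 (n + n') / 2 * ((HiggsLattice.Site.tdist x x' : ℝ) / (P.L : ℝ) ^ k))) := by
  set M := n + n' with hM
  obtain ⟨hr0, -, -, hcd0, hcS0⟩ := seqB_pos (P := P) (N := N) (C := C) (k := k) (nF := nF) (a := a) (cK2 := cK2) (cK1 := cK1) (s := s)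
    (δA := δA) (δ₀ := δ₁) (cv₀ := cK2) (cd₀ := cK1) hL hδ₁ le_rfl hcK2 hcK1 hcK2 hcK1 hs hδA M
  set δM := rateB P N C k nF a cK2 cK1 s δA δ₁ cK2 cK1 M with hδM
  have hδM1 : δM ≤ 1 := by
    obtain ⟨-, h, -⟩ := seqB_pos (P := P) (N := N) (C := C) (k := k) (nF := nF) (a := a) (cK2 := cK2) (cK1 := cK1) (s := s)
      (δA := δA) (δ₀ := δ₁) (cv₀ := cK2) (cd₀ := cK1) hL hδ₁ le_rfl hcK2 hcK1 hcK2 hcK1 hs hδA M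
    exact h.trans hδ₁1
  have hL1 : (1 : ℝ) < (P.L : ℝ) := by exact_mod_cast hL
  have hsM : 0 < (1 : ℝ) + (M : ℝ) - (P.d : ℝ) := by linarith
  have hsM1 : (1 : ℝ) < 1 + (M : ℝ) := by
    have hd1 : (1 : ℝ) ≤ (P.d : ℝ) := by exact_mod_cast P.hd
    linarith
  have hε : 0 ≤ (P.mesh 0 ^ P.d)⁻¹ := inv_nonneg.mpr (pow_nonneg (P.mesh_pos 0).le _)
  have hbase := kernel116_deriv_box_le hL hk hkK hmsq hak hΩ hcK2 hcK1 hcolB hdcolB hcolAB hdcolAB hδ₁ hδ₁1 hs hA hδA hregA i₀ hF hexF henF hx'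
    n n' hd μ x hxμ
  -- the sheet under the margin, then at the top scale
  have hsheet := end_sheet_margin_le hL (k := k) hr0 hδM1 hθ hsM1 hcK1 hcS0 F ν c hF x x' hh
  have hSC := sheetEndC_nonneg hL (δ := δM) hr0 hθ hsM1 hcK1 hcS0
  have htop : maj P k (sheetEndC P δM θ (1 + (M : ℝ)) cK1 (cSB P N C k nF a cK2 cK1 s δA δ₁ cK2 cK1 M)) (1 + (M : ℝ)) (δM / 2) x x'
      ≤ sheetEndC P δM θ (1 + (M : ℝ)) cK1 (cSB P N C k nF a cK2 cK1 s δA δ₁ cK2 cK1 M) / ((P.L : ℝ) ^ ((1 : ℝ) + (M : ℝ) - (P.d : ℝ)) - 1) *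
          P.mesh k ^ ((1 : ℝ) + (M : ℝ) - (P.d : ℝ)) * Real.exp (-(δM / 2 * (P.mesh k)⁻¹ * (P.mesh 0 * (HiggsLattice.Site.tdist x x' : ℝ)))) := by
    unfold maj
    exact majorant_le_top hL hSC hsM (by positivity) x x'
  -- the regular part at the weaker rate δ_M/2
  have hexp : Real.exp (-(δM * ((HiggsLattice.Site.tdist x x' : ℝ) / (P.L : ℝ) ^ k)))
      ≤ Real.exp (-(δM / 2 * ((HiggsLattice.Site.tdist x x' : ℝ) / (P.L : ℝ) ^ k))) := by
    apply Real.exp_le_exp.mpr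
    have : 0 ≤ δM * ((HiggsLattice.Site.tdist x x' : ℝ) / (P.L : ℝ) ^ k) := by positivity
    linarith
  have hreg0 : 0 ≤ derCB P N C k nF a cK2 cK1 s δA δ₁ M * P.mesh k ^ M * (P.mesh k * (P.mesh k ^ P.d)⁻¹) := by
    have hpow : 1 < (P.L : ℝ) ^ ((1 : ℝ) + (M : ℝ) - (P.d : ℝ)) := Real.one_lt_rpow hL1 hsM
    have h1 : 0 ≤ derCB P N C k nF a cK2 cK1 s δA δ₁ M := by
      unfold derCB
      exact mul_nonneg (mul_nonneg hε (Nat.cast_nonneg _)) (div_nonneg hcd0 (by linarith))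
    have := P.mesh_pos k
    positivity
  have hreg := mul_le_mul_of_nonneg_left hexp hreg0
  -- assemble
  refine hbase.trans ?_
  have hsh2 : (P.mesh 0 ^ P.d)⁻¹ * (Fintype.card (Ix N) : ℝ) *
        ∑ i : Fin nF, ∑ u ∈ F i, maj P k cK1 1 δM x u * maj P k (cSB P N C k nF a cK2 cK1 s δA δ₁ cK2 cK1 M) (1 + (M : ℝ)) δM u x'
      ≤ (P.mesh 0 ^ P.d)⁻¹ * (Fintype.card (Ix N) : ℝ) * ((nF : ℝ) *
          (sheetEndC P δM θ (1 + (M : ℝ)) cK1 (cSB P N C k nF a cK2 cK1 s δA δ₁ cK2 cK1 M) / ((P.L : ℝ) ^ ((1 : ℝ) + (M : ℝ) - (P.d : ℝ)) - 1) *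
            P.mesh k ^ ((1 : ℝ) + (M : ℝ) - (P.d : ℝ)) * Real.exp (-(δM / 2 * (P.mesh k)⁻¹ * (P.mesh 0 * (HiggsLattice.Site.tdist x x' : ℝ)))))) :=
    mul_le_mul_of_nonneg_left (hsheet.trans (mul_le_mul_of_nonneg_left htop (Nat.cast_nonneg _))) (mul_nonneg hε (Nat.cast_nonneg _))
  have hM' : ((n + n' : ℕ) : ℝ) = (M : ℝ) := by rw [hM]
  rw [hM'] at hsh2 ⊢
  refine (add_le_add hreg hsh2).trans (le_of_eq ?_)
  rw [mesh_rpow_split_one, rate_div_eq, derCBθ]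
  ring

end Kernel

/-! ## §3 The (C)-level theorems on a cell-product box -/

section CellBox

/-- **THE KERNEL OF (1.16) ON A CELL-PRODUCT BOX IS UNIFORMLY BOUNDED AND EXPONENTIALLY DECAYING AT EVERY POINT, FOR ALL `n + n′ + 2 > d`, WITH
NO SUPPORT CLAUSE ON THE PERTURBATION** (see the module docstring §3 for the quantifiers): the value binder `hV` of (2.5) for (1.16) on `□`.
[cite: Balaban1983Higgs3, (1.16) p.414, (2.5) p.424, (2.10) p.426, p.433] [cite: Balaban1982Higgs1, Prop. 2.1 p.610, p.611 l.1–2, (3.16) p.615] -/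
theorem kernel116_value_cellBox_le (d L : ℕ) (hd : 1 ≤ d) (hL : 2 ≤ L) {a : ℝ} (ha : 0 < a) {msq : ℝ} (hmsq : 0 < msq) (N : ℕ)
    (C : ChargeData N) :
    ∃ K₀min : ℕ, ∀ K₀ : ℕ, K₀min ≤ K₀ → ∃ t δ₁ Cst : ℝ, 0 < t ∧ 0 < δ₁ ∧ δ₁ ≤ 1 ∧ 0 < Cst ∧
      ∀ (P : HiggsLattice.Params), 1 < P.L → P.d = d → P.L = L → K₀ ∣ P.M →
      ∀ {k : ℕ}, 1 ≤ k → k ≤ P.K → (∀ μ, 3 * half P k K₀ ≤ P.sitesPerDir 0 μ) → P.mesh k ≤ 1 →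
      ∀ (S : Fin P.d → Finset ℕ) (A B : HiggsLattice.VecField P 0) {s δA δB δAB : ℝ}, 0 ≤ s → 0 ≤ δA → 0 ≤ δB → 0 ≤ δAB →
        (∀ b : HiggsLattice.PBond P 0, |A b| ≤ s) →
        (∀ (z : HiggsLattice.Site P 0) (μ ν : Fin P.d), |A ⟨z.shift ν, μ⟩ - A ⟨z, μ⟩| ≤ δA) →
        (∀ z ∈ cellBox k K₀ S, ∀ μ ν : Fin P.d, |B ⟨z.shift ν, μ⟩ - B ⟨z, μ⟩| ≤ δB) → (P.L : ℝ) ^ k * δB * |C.e| ≤ t →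
        (∀ z ∈ cellBox k K₀ S, ∀ μ ν : Fin P.d, |(A + B) ⟨z.shift ν, μ⟩ - (A + B) ⟨z, μ⟩| ≤ δAB) → (P.L : ℝ) ^ k * δAB * |C.e| ≤ t →
        ∀ (i₀ : Ix N) (n n' : ℕ), (P.d : ℝ) < (n + n' : ℕ) + 2 →
        ∀ x' ∈ cellBox k K₀ S, ∀ x : HiggsLattice.Site P 0,
          (P.mesh 0 ^ P.d)⁻¹ * ∑ i' : Ix N, ‖op116 C (cellBox k K₀ S) A B msq a k n n' (cb P N 0 (x', i')) x‖
            ≤ valCB P N C k (faces k K₀ S).card a (P.mesh 0 ^ P.d * Cst) (cK1 P C k Cst s) s δA δ₁ (n + n') * P.mesh k ^ (n + n') *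
                (P.mesh k ^ 2 * (P.mesh k ^ P.d)⁻¹) *
              Real.exp (-(rateB P N C k (faces k K₀ S).card a (P.mesh 0 ^ P.d * Cst) (cK1 P C k Cst s) s δA δ₁ (P.mesh 0 ^ P.d * Cst)
                (cK1 P C k Cst s) (n + n') * ((HiggsLattice.Site.tdist x x' : ℝ) / (P.L : ℝ) ^ k))) := by
  classical
  obtain ⟨K₀min, hbox⟩ := colB_dcolB_le d L hd hL ha hmsq N C
  refine ⟨K₀min, fun K₀ hK₀ => ?_⟩
  obtain ⟨t, δ₁, Cst, ht, hδ₁, hCst, hbox⟩ := hbox K₀ hK₀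
  -- the rate is cut at 1 (the shift lemmas of the majorant currency want `δ ≤ 1`)
  refine ⟨t, min δ₁ 1, Cst, ht, lt_min hδ₁ one_pos, min_le_right _ _, hCst, ?_⟩
  intro P hP1 hPd hPL hK₀M k hk1 hkK h3 hmesh S A B s δA δB δAB hs hδA hδB hδAB hA hregA hregB htB hregAB htAB i₀ n n' hdn x' hx' x
  set Ω := cellBox k K₀ S with hΩdef
  have hL1' : (1 : ℝ) < (P.L : ℝ) := by exact_mod_cast hP1
  have hak : 0 ≤ B1.aSeq a P.L k := (B1.aSeq_pos ha hL1' hk1).le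
  have hc : 0 ≤ P.mesh 0 ^ P.d * Cst := mul_nonneg (pow_nonneg (P.mesh_pos 0).le _) hCst.le
  obtain ⟨-, hcK1⟩ := cK1_ge (P := P) (C := C) (k := k) hCst.le hs
  have hmin : min δ₁ 1 ≤ δ₁ := min_le_left _ _
  -- the dictionary of both propagators on the box, at the rate `min δ₁ 1`
  have hB := fun x y hx hy => hbox P hP1 hPd hPL hK₀M hk1 hkK h3 hmesh S B hδB hregB htB x y hx hy
  have hAB := fun x y hx hy => hbox P hP1 hPd hPL hK₀M hk1 hkK h3 hmesh S (A + B) hδAB hregAB htAB x y hx hy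
  have hcolB : ∀ x ∈ Ω, ∀ z ∈ Ω, ∑ i : Ix N, ‖propagatorK C Ω B msq a k (cb P N 0 (z, i)) x‖ ≤ maj P k (P.mesh 0 ^ P.d * Cst) 2 (min δ₁ 1) x z :=
    fun x hx z hz => le_trans (hB x z hx hz).1 (maj_rate_mono hc hmin x z)
  have hcolAB : ∀ x ∈ Ω, ∀ z ∈ Ω,
      ∑ i : Ix N, ‖propagatorK C Ω (A + B) msq a k (cb P N 0 (z, i)) x‖ ≤ maj P k (P.mesh 0 ^ P.d * Cst) 2 (min δ₁ 1) x z :=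
    fun x hx z hz => le_trans (hAB x z hx hz).1 (maj_rate_mono hc hmin x z)
  have hdcolB : ∀ b : HiggsLattice.PBond P 0, Inside Ω b → ∀ z ∈ Ω,
      ∑ i : Ix N, ‖covDeriv C B (propagatorK C Ω B msq a k (cb P N 0 (z, i))) b‖ ≤ maj P k (cK1 P C k Cst s) 1 (min δ₁ 1) b.src z := by
    intro b hb z hz
    have h := (hB b.src z hb.1 hz).2 b.dir hb.2
    exact (h.trans (maj_rate_mono hc hmin _ z)).trans
      (maj_const_mono (cK1_ge (P := P) (C := C) (k := k) hCst.le hs).1 _ z)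
  have hdcolAB : ∀ b : HiggsLattice.PBond P 0, Inside Ω b → ∀ z ∈ Ω,
      ∑ i : Ix N, ‖covDeriv C B (propagatorK C Ω (A + B) msq a k (cb P N 0 (z, i))) b‖ ≤ maj P k (cK1 P C k Cst s) 1 (min δ₁ 1) b.src z := by
    refine dcol_split_le_maj (lt_min hδ₁ one_pos) (min_le_right _ _) hCst.le hs hA hcolAB (fun b hb z hz => ?_)
    have h := (hAB b.src z hb.1 hz).2 b.dir hb.2
    exact h.trans (maj_rate_mono hc hmin _ z)
  exact kernel116_value_box_le hP1 hk1 hkK hmsq hak (cellBox_blockUnion le_rfl S) hc hcK1 hcolB hdcolB hcolAB hdcolAB (lt_min hδ₁ one_pos)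
    (min_le_right _ _) hs hA hδA hregA i₀ (faceFam_level k K₀ S) (exB_cover_cellBox k K₀ S A) (enB_cover_cellBox k K₀ S A) hx' n n' hdn x

/-- **THE ROW DERIVATIVE OF THE KERNEL OF (1.16) ON A CELL-PRODUCT BOX IS UNIFORMLY BOUNDED AND EXPONENTIALLY DECAYING AT EVERY BOND ONE TOP
BLOCK INSIDE THE FACES, FOR ALL `n + n′ + 1 > d`, WITH NO SUPPORT CLAUSE ON THE PERTURBATION**: under the hypotheses of `kernel116_value_cellBox_le`,
at every bond `⟨x, x+εe_μ⟩ ⊂ □` with `θL^k ≤ min((x_ν − r).val, (r − x_ν).val)` for every face slice `(ν, r)` of `□` (`θ > 0`): the derivative binder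
`hDv` of (2.5) for (1.16) on `□`, rate `δ_{n+n′}/2`, UNIFORM IN `k`. [cite: Balaban1983Higgs3, (1.16) p.414, (2.5) p.424, (2.10) p.426, p.433] [cite: Balaban1982Higgs1, Prop. 2.1 p.610, p.611 l.1–2, (3.16) p.615] -/
theorem kernel116_deriv_cellBox_margin_le (d L : ℕ) (hd : 1 ≤ d) (hL : 2 ≤ L) {a : ℝ} (ha : 0 < a) {msq : ℝ} (hmsq : 0 < msq) (N : ℕ)
    (C : ChargeData N) :
    ∃ K₀min : ℕ, ∀ K₀ : ℕ, K₀min ≤ K₀ → ∃ t δ₁ Cst : ℝ, 0 < t ∧ 0 < δ₁ ∧ δ₁ ≤ 1 ∧ 0 < Cst ∧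
      ∀ (P : HiggsLattice.Params), 1 < P.L → P.d = d → P.L = L → K₀ ∣ P.M →
      ∀ {k : ℕ}, 1 ≤ k → k ≤ P.K → (∀ μ, 3 * half P k K₀ ≤ P.sitesPerDir 0 μ) → P.mesh k ≤ 1 →
      ∀ (S : Fin P.d → Finset ℕ) (A B : HiggsLattice.VecField P 0) {s δA δB δAB : ℝ}, 0 ≤ s → 0 ≤ δA → 0 ≤ δB → 0 ≤ δAB →
        (∀ b : HiggsLattice.PBond P 0, |A b| ≤ s) →
        (∀ (z : HiggsLattice.Site P 0) (μ ν : Fin P.d), |A ⟨z.shift ν, μ⟩ - A ⟨z, μ⟩| ≤ δA) →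
        (∀ z ∈ cellBox k K₀ S, ∀ μ ν : Fin P.d, |B ⟨z.shift ν, μ⟩ - B ⟨z, μ⟩| ≤ δB) → (P.L : ℝ) ^ k * δB * |C.e| ≤ t →
        (∀ z ∈ cellBox k K₀ S, ∀ μ ν : Fin P.d, |(A + B) ⟨z.shift ν, μ⟩ - (A + B) ⟨z, μ⟩| ≤ δAB) → (P.L : ℝ) ^ k * δAB * |C.e| ≤ t →
        ∀ (i₀ : Ix N) (n n' : ℕ), (P.d : ℝ) < (n + n' : ℕ) + 1 →
        ∀ x' ∈ cellBox k K₀ S, ∀ (μ : Fin P.d) (x : HiggsLattice.Site P 0), Inside (cellBox k K₀ S) ⟨x, μ⟩ →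
        ∀ {θ : ℝ}, 0 < θ → (∀ f ∈ faces k K₀ S, θ * (P.L : ℝ) ^ k ≤ ((min (x f.1 - f.2).val (f.2 - x f.1).val : ℕ) : ℝ)) →
          (P.mesh 0 ^ P.d)⁻¹ * ∑ i' : Ix N, ‖covDeriv C B (op116 C (cellBox k K₀ S) A B msq a k n n' (cb P N 0 (x', i'))) ⟨x, μ⟩‖
            ≤ derCBθ P N C k (faces k K₀ S).card a (P.mesh 0 ^ P.d * Cst) (cK1 P C k Cst s) s δA δ₁ θ (n + n') * P.mesh k ^ (n + n') *
                (P.mesh k * (P.mesh k ^ P.d)⁻¹) *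
              Real.exp (-(rateB P N C k (faces k K₀ S).card a (P.mesh 0 ^ P.d * Cst) (cK1 P C k Cst s) s δA δ₁ (P.mesh 0 ^ P.d * Cst)
                (cK1 P C k Cst s) (n + n') / 2 * ((HiggsLattice.Site.tdist x x' : ℝ) / (P.L : ℝ) ^ k))) := by
  classical
  obtain ⟨K₀min, hbox⟩ := colB_dcolB_le d L hd hL ha hmsq N C
  refine ⟨K₀min, fun K₀ hK₀ => ?_⟩
  obtain ⟨t, δ₁, Cst, ht, hδ₁, hCst, hbox⟩ := hbox K₀ hK₀
  refine ⟨t, min δ₁ 1, Cst, ht, lt_min hδ₁ one_pos, min_le_right _ _, hCst, ?_⟩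
  intro P hP1 hPd hPL hK₀M k hk1 hkK h3 hmesh S A B s δA δB δAB hs hδA hδB hδAB hA hregA hregB htB hregAB htAB i₀ n n' hdn x' hx' μ x hxμ θ hθ hh
  set Ω := cellBox k K₀ S with hΩdef
  have hL1' : (1 : ℝ) < (P.L : ℝ) := by exact_mod_cast hP1
  have hak : 0 ≤ B1.aSeq a P.L k := (B1.aSeq_pos ha hL1' hk1).le
  have hc : 0 ≤ P.mesh 0 ^ P.d * Cst := mul_nonneg (pow_nonneg (P.mesh_pos 0).le _) hCst.le
  obtain ⟨-, hcK1⟩ := cK1_ge (P := P) (C := C) (k := k) hCst.le hs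
  have hmin : min δ₁ 1 ≤ δ₁ := min_le_left _ _
  have hB := fun x y hx hy => hbox P hP1 hPd hPL hK₀M hk1 hkK h3 hmesh S B hδB hregB htB x y hx hy
  have hAB := fun x y hx hy => hbox P hP1 hPd hPL hK₀M hk1 hkK h3 hmesh S (A + B) hδAB hregAB htAB x y hx hy
  have hcolB : ∀ x ∈ Ω, ∀ z ∈ Ω, ∑ i : Ix N, ‖propagatorK C Ω B msq a k (cb P N 0 (z, i)) x‖ ≤ maj P k (P.mesh 0 ^ P.d * Cst) 2 (min δ₁ 1) x z :=
    fun x hx z hz => le_trans (hB x z hx hz).1 (maj_rate_mono hc hmin x z)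
  have hcolAB : ∀ x ∈ Ω, ∀ z ∈ Ω,
      ∑ i : Ix N, ‖propagatorK C Ω (A + B) msq a k (cb P N 0 (z, i)) x‖ ≤ maj P k (P.mesh 0 ^ P.d * Cst) 2 (min δ₁ 1) x z :=
    fun x hx z hz => le_trans (hAB x z hx hz).1 (maj_rate_mono hc hmin x z)
  have hdcolB : ∀ b : HiggsLattice.PBond P 0, Inside Ω b → ∀ z ∈ Ω,
      ∑ i : Ix N, ‖covDeriv C B (propagatorK C Ω B msq a k (cb P N 0 (z, i))) b‖ ≤ maj P k (cK1 P C k Cst s) 1 (min δ₁ 1) b.src z := by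
    intro b hb z hz
    have h := (hB b.src z hb.1 hz).2 b.dir hb.2
    exact (h.trans (maj_rate_mono hc hmin _ z)).trans
      (maj_const_mono (cK1_ge (P := P) (C := C) (k := k) hCst.le hs).1 _ z)
  have hdcolAB : ∀ b : HiggsLattice.PBond P 0, Inside Ω b → ∀ z ∈ Ω,
      ∑ i : Ix N, ‖covDeriv C B (propagatorK C Ω (A + B) msq a k (cb P N 0 (z, i))) b‖ ≤ maj P k (cK1 P C k Cst s) 1 (min δ₁ 1) b.src z := by
    refine dcol_split_le_maj (lt_min hδ₁ one_pos) (min_le_right _ _) hCst.le hs hA hcolAB (fun b hb z hz => ?_)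
    have h := (hAB b.src z hb.1 hz).2 b.dir hb.2
    exact h.trans (maj_rate_mono hc hmin _ z)
  exact kernel116_deriv_box_margin_le hP1 hk1 hkK hmsq hak (cellBox_blockUnion le_rfl S) hc hcK1 hcolB hdcolB hcolAB hdcolAB
    (lt_min hδ₁ one_pos) (min_le_right _ _) hs hA hδA hregA i₀ (faceFam_level k K₀ S) (exB_cover_cellBox k K₀ S A) (enB_cover_cellBox k K₀ S A)
    hx' n n' hdn μ x hxμ hθ (height_faceFam k K₀ S hh)

end CellBox

/-! ## §4 The derivative binder at `Interior` points (p40's `hDv` shape) -/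

section InteriorBinder

open B3Ineq210RegularRegion (Interior)

/-- **THE ROW DERIVATIVE OF THE KERNEL OF (1.16) ON A CELL-PRODUCT BOX AT `Interior` POINTS** — `kernel116_deriv_cellBox_margin_le` with the bond and
height hypotheses discharged by `Interior k K₀ □ x` (`θ = 1`; `K₀,min ≥ 1`): exactly the binder `hDv` of p40's
`B3Ineq25Op116Smooth.ineq25At_op116_smooth_of_bounds` on `Ω = □` (there `x′` is also interior; here `x′ ∈ □` suffices), no support clause on `Ã`.
[cite: Balaban1983Higgs3, (1.16) p.414, (2.5) p.424, (2.10) p.426, p.433] [cite: Balaban1982Higgs1, Prop. 2.1 p.610, p.611 l.1–2] -/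
theorem kernel116_deriv_cellBox_interior_le (d L : ℕ) (hd : 1 ≤ d) (hL : 2 ≤ L) {a : ℝ} (ha : 0 < a) {msq : ℝ} (hmsq : 0 < msq) (N : ℕ)
    (C : ChargeData N) :
    ∃ K₀min : ℕ, ∀ K₀ : ℕ, K₀min ≤ K₀ → ∃ t δ₁ Cst : ℝ, 0 < t ∧ 0 < δ₁ ∧ δ₁ ≤ 1 ∧ 0 < Cst ∧
      ∀ (P : HiggsLattice.Params), 1 < P.L → P.d = d → P.L = L → K₀ ∣ P.M →
      ∀ {k : ℕ}, 1 ≤ k → k ≤ P.K → (∀ μ, 3 * half P k K₀ ≤ P.sitesPerDir 0 μ) → P.mesh k ≤ 1 →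
      ∀ (S : Fin P.d → Finset ℕ) (A B : HiggsLattice.VecField P 0) {s δA δB δAB : ℝ}, 0 ≤ s → 0 ≤ δA → 0 ≤ δB → 0 ≤ δAB →
        (∀ b : HiggsLattice.PBond P 0, |A b| ≤ s) →
        (∀ (z : HiggsLattice.Site P 0) (μ ν : Fin P.d), |A ⟨z.shift ν, μ⟩ - A ⟨z, μ⟩| ≤ δA) →
        (∀ z ∈ cellBox k K₀ S, ∀ μ ν : Fin P.d, |B ⟨z.shift ν, μ⟩ - B ⟨z, μ⟩| ≤ δB) → (P.L : ℝ) ^ k * δB * |C.e| ≤ t →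
        (∀ z ∈ cellBox k K₀ S, ∀ μ ν : Fin P.d, |(A + B) ⟨z.shift ν, μ⟩ - (A + B) ⟨z, μ⟩| ≤ δAB) → (P.L : ℝ) ^ k * δAB * |C.e| ≤ t →
        ∀ (i₀ : Ix N) (n n' : ℕ), (P.d : ℝ) < (n + n' : ℕ) + 1 →
        ∀ x' ∈ cellBox k K₀ S, ∀ (μ : Fin P.d) (x : HiggsLattice.Site P 0), Interior k K₀ (cellBox k K₀ S) x →
          (P.mesh 0 ^ P.d)⁻¹ * ∑ i' : Ix N, ‖covDeriv C B (op116 C (cellBox k K₀ S) A B msq a k n n' (cb P N 0 (x', i'))) ⟨x, μ⟩‖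
            ≤ derCBθ P N C k (faces k K₀ S).card a (P.mesh 0 ^ P.d * Cst) (cK1 P C k Cst s) s δA δ₁ 1 (n + n') * P.mesh k ^ (n + n') *
                (P.mesh k * (P.mesh k ^ P.d)⁻¹) *
              Real.exp (-(rateB P N C k (faces k K₀ S).card a (P.mesh 0 ^ P.d * Cst) (cK1 P C k Cst s) s δA δ₁ (P.mesh 0 ^ P.d * Cst)
                (cK1 P C k Cst s) (n + n') / 2 * ((HiggsLattice.Site.tdist x x' : ℝ) / (P.L : ℝ) ^ k))) := by
  obtain ⟨K₀min, h⟩ := kernel116_deriv_cellBox_margin_le d L hd hL ha hmsq N C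
  refine ⟨max K₀min 1, fun K₀ hK₀ => ?_⟩
  obtain ⟨t, δ₁, Cst, ht, hδ₁, hδ₁1, hCst, h⟩ := h K₀ ((le_max_left _ _).trans hK₀)
  refine ⟨t, δ₁, Cst, ht, hδ₁, hδ₁1, hCst, ?_⟩
  intro P hP1 hPd hPL hK₀M k hk1 hkK h3 hmesh S A B s δA δB δAB hs hδA hδB hδAB hA hregA hregB htB hregAB htAB i₀ n n' hdn x' hx' μ x hx
  exact h P hP1 hPd hPL hK₀M hk1 hkK h3 hmesh S A B hs hδA hδB hδAB hA hregA hregB htB hregAB htAB i₀ n n' hdn x' hx' μ x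
    (inside_of_interior hx μ) one_pos (faces_height_of_interior ((le_max_right _ _).trans hK₀) hx)

end InteriorBinder

end Literature.MathematicalPhysics.QuantumFieldTheory.Balaban1983to89.B3Op116DKernelRegularCellBox

end
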